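import Summits.ResolutionOfSingularities.ResolutionOfSingularities.Theorems.RadicialJungCleanModelsCcurvePointPrepWeak
import Summits.ResolutionOfSingularities.ResolutionOfSingularities.Theorems.RadicialJungCleanModelsCcurveRegInside
import HarnessLib

/-!
# Route `RadicialJung`, crux `CleanModels` (stmt-15917) — (C-curve) sub-line over ARBITRARY ground fields, brick 3: point preparation STAYS INSIDE the local ring
# at the centre curve

Lead `res-B-lead-1` g7 (towards Sketch rev 30: the unit case `persistForm2` without `PerfectField k`).  OURS · counted 0.  Nothing here proves resolution in
characteristic `p`; resolution in char `p` is NOT proved.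

The blow-ups of ✓ `exists_model_rsop_div_pow` (iterated blow-up of the curve `{t = t₂ = 0}` along `O`, charts `t ↦ t/t₂`) and of ✓ `Ccurve.pointPrep_weak` (the `n`
point blow-ups at the point of the centre curve, charts `x ↦ x/z`, `y ↦ y/z`) only invert `t₂` resp. `z`; so their local rings stay inside any subring
`R ⊇ locAtCentre B′ O` containing `t₂⁻¹` (resp. `z⁻¹`) and closed under localisation at the centre of `O` — in particular inside `R₁ = locAtCentre B′ O₁` for a
coarsening `O ≤ O₁` making `z` a unit (`exists_model_rsop_div_pow_le`, `pointPrep_weak_le`).  Same proofs as the originals, with the containment carried along.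
-/

noncomputable section

set_option linter.dupNamespace false

open IsLocalRing Literature.AlgebraicGeometry.Resolution
open Summit.ResolutionOfSingularities.ResolutionOfSingularities.Theorems

namespace Summit.ResolutionOfSingularities.ResolutionOfSingularities.Theorems.RadicialJung.CleanModels.Ccurve

variable {K : Type} [Field K] {k : Type} [Field k] [Algebra k K]

/-- ✓ `exists_model_rsop_div_pow` WITH CONTAINMENT: if `locAtCentre A₁ O ≤ R`, `t₂⁻¹ ∈ R` and `locAtCentre R O ≤ R`, the output local ring lies in `R`. [folklore] -/
theorem exists_model_rsop_div_pow_le (O : ValuationSubring K) (A : Subalgebra k K) (hAfg : A.FG) [IsFractionRing A K]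
    (hzd : ∀ (T : Subring K) (hT : T ≤ O.toSubring), A.toSubring ≤ T → (subringCentre T O hT).IsMaximal)
    (hdimA : ringKrullDim A = 3) (R : Subring K) (hRloc : locAtCentre R O ≤ R) :
    ∀ (n : ℕ) (A₁ : Subalgebra k K) (_ : A ≤ A₁) (_ : A₁.FG) (hA₁O : A₁.toSubring ≤ O.toSubring)
      (_ : IsRegularLocalRing (locAtCentre A₁.toSubring O))
      (t t₂ t₃ : K) (ht : t ∈ locAtCentre A₁.toSubring O) (ht₂ : t₂ ∈ locAtCentre A₁.toSubring O)
      (ht₃ : t₃ ∈ locAtCentre A₁.toSubring O),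
      (haveI := isLocalRing_locAtCentre hA₁O; maximalIdeal (locAtCentre A₁.toSubring O)) =
        Ideal.span {⟨t, ht⟩, ⟨t₂, ht₂⟩, ⟨t₃, ht₃⟩} →
      (∀ m : ℕ, O.valuation t < O.valuation (t₂ ^ (m + 1))) →
      locAtCentre A₁.toSubring O ≤ R → t₂⁻¹ ∈ R →
      ∃ (A₂ : Subalgebra k K), A ≤ A₂ ∧ A₂.FG ∧ ∃ (hA₂O : A₂.toSubring ≤ O.toSubring),
        IsRegularLocalRing (locAtCentre A₂.toSubring O) ∧ locAtCentre A₁.toSubring O ≤ locAtCentre A₂.toSubring O ∧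
        locAtCentre A₂.toSubring O ≤ R ∧
        ∃ (h₁ : t / t₂ ^ n ∈ locAtCentre A₂.toSubring O) (h₂ : t₂ ∈ locAtCentre A₂.toSubring O)
          (h₃ : t₃ ∈ locAtCentre A₂.toSubring O),
          (haveI := isLocalRing_locAtCentre hA₂O; maximalIdeal (locAtCentre A₂.toSubring O)) =
            Ideal.span {⟨_, h₁⟩, ⟨_, h₂⟩, ⟨_, h₃⟩} := by
  intro n
  induction n with
  | zero =>
    intro A₁ hAA₁ hA₁fg hA₁O hreg₁ t t₂ t₃ ht ht₂ ht₃ hmax _ hA₁R _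
    refine ⟨A₁, hAA₁, hA₁fg, hA₁O, hreg₁, le_rfl, hA₁R, ?_, ht₂, ht₃, ?_⟩
    · rw [pow_zero, div_one]; exact ht
    · refine hmax.trans ?_
      congr 2
      apply Subtype.ext
      change t = t / t₂ ^ 0
      rw [pow_zero, div_one]
  | succ n ih =>
    intro A₁ hAA₁ hA₁fg hA₁O hreg₁ t t₂ t₃ ht ht₂ ht₃ hmax hdeep hA₁R ht₂inv
    obtain ⟨A₂, hAA₂, hA₂fg, hA₂O, hreg₂, h12, hA₂R, h₁, h₂, h₃, hmax₂⟩ :=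
      ih A₁ hAA₁ hA₁fg hA₁O hreg₁ t t₂ t₃ ht ht₂ ht₃ hmax hdeep hA₁R ht₂inv
    set R₂ := locAtCentre A₂.toSubring O with hR₂
    haveI := hreg₂
    have hdimA₂ : ringKrullDim (locAtCentre A₂.toSubring O) = 3 := by
      rw [ringKrullDim_locAtCentre_eq_of_isMaximal A₂ hA₂fg O hA₂O (hzd _ hA₂O (fun z hz => hAA₂ hz)),
        ringKrullDim_eq_of_fg_of_le hAfg hA₂fg hAA₂, hdimA]
    have hd : (maximalIdeal R₂).spanFinrank = 3 := spanFinrank_eq_three_of_dim R₂ hdimA₂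
    have hR₂O : R₂ ≤ O.toSubring := locAtCentre_le hA₂O
    have hdom₂ : SubringDominates R₂ O.toSubring := subringDominates_locAtCentre hA₂O
    have ht₂0 : t₂ ≠ 0 := by
      intro h0; have := hdeep 0; rw [h0, zero_pow (by norm_num), map_zero] at this; exact not_lt.mpr zero_le this
    have hv : O.valuation ((⟨t / t₂ ^ n, h₁⟩ : R₂) : K) < O.valuation ((⟨t₂, h₂⟩ : R₂) : K) := by
      change O.valuation (t / t₂ ^ n) < O.valuation t₂
      rw [map_div₀, map_pow, div_lt_iff₀ (pow_pos (zero_lt_iff.mpr ((Valuation.ne_zero_iff _).mpr ht₂0)) n), ← pow_succ',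
        ← map_pow]
      exact hdeep n
    have hspan : Ideal.span {(⟨t / t₂ ^ n, h₁⟩ : R₂), ⟨t₂, h₂⟩, ⟨t₃, h₃⟩} = maximalIdeal R₂ := hmax₂.symm
    obtain ⟨R', hR'eq, h2R', hR'O, hreg', -, g₁, g₂, g₃, hmax'⟩ :=
      curveChart_step O R₂ hR₂O hdom₂ hd ⟨_, h₁⟩ ⟨_, h₂⟩ ⟨_, h₃⟩ hspan hv
    have hlb : IsLocalBlowup O R₂ R' := by
      refine ⟨hR₂O, {t / t₂ ^ n / t₂}, ?_, ?_⟩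
      · intro z hz
        rw [Finset.coe_singleton, Set.mem_singleton_iff] at hz
        rw [hz]
        exact hR'O g₁
      · rw [Finset.coe_singleton]; exact hR'eq
    -- containment in `R`
    have hR'R : R' ≤ R := by
      rw [hR'eq]
      refine le_trans (locAtCentre_mono O ?_) hRloc
      rw [Subring.closure_le]
      rintro w (hw | hw)
      · exact hA₂R hw
      · rw [Set.mem_singleton_iff] at hw
        rw [hw]
        change t / t₂ ^ n / t₂ ∈ R
        rw [div_eq_mul_inv]
        exact Subring.mul_mem _ (hA₂R h₁) ht₂inv
    obtain ⟨A₃, hA₃O, hAA₃, hA₃fg, hR'A₃⟩ := exists_model_of_isLocalBlowup hAA₂ hA₂fg hlb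
    subst hR'A₃
    refine ⟨A₃, hAA₃, hA₃fg, hA₃O, hreg', h12.trans h2R', hR'R, ?_, g₂, g₃, ?_⟩
    · have : t / t₂ ^ (n + 1) = t / t₂ ^ n / t₂ := by rw [pow_succ, div_div]
      rw [this]; exact g₁
    · refine hmax'.trans ?_
      congr 2
      apply Subtype.ext
      change t / t₂ ^ n / t₂ = t / t₂ ^ (n + 1)
      rw [pow_succ, div_div]

/-- ✓ `Ccurve.pointPrep_weak` WITH CONTAINMENT in `R₁ = locAtCentre B′ O₁`: the `n` point blow-ups at the point of the centre curve of `O₁` keep the local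
ring at the centre of `O` inside `R₁` (only the `O₁`-unit `z` is inverted). [folklore] -/
theorem pointPrep_weak_le :
    ∀ (k : Type) [Field k] (K : Type) [Field K] [Algebra k K]
    (O : ValuationSubring K) (A : Subalgebra k K), A.toSubring ≤ O.toSubring → A.FG → IsFractionRing A K → ringKrullDim A ≤ 3 →
    (∀ (T : Subring K) (hT : T ≤ O.toSubring), A.toSubring ≤ T → (subringCentre T O hT).IsMaximal) →
    ∀ (B' : Subalgebra k K) (hB'O : B'.toSubring ≤ O.toSubring), A ≤ B' → B'.FG →
    IsRegularLocalRing (locAtCentre B'.toSubring O) → ringKrullDim (locAtCentre B'.toSubring O) = 3 →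
    ∀ (O₁ : ValuationSubring K), O ≤ O₁ →
    ∀ (x y z : K) (hx : x ∈ locAtCentre B'.toSubring O) (hy : y ∈ locAtCentre B'.toSubring O) (hz : z ∈ locAtCentre B'.toSubring O),
      (haveI := isLocalRing_locAtCentre hB'O; IsLocalRing.maximalIdeal (locAtCentre B'.toSubring O)) =
        Ideal.span {⟨x, hx⟩, ⟨y, hy⟩, ⟨z, hz⟩} →
      (∀ w : ↥(locAtCentre B'.toSubring O), O₁.valuation (w : K) < 1 ↔ w ∈ Ideal.span {(⟨x, hx⟩ : ↥(locAtCentre B'.toSubring O)), ⟨y, hy⟩}) →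
    ∀ n : ℕ,
    ∃ (B'' : Subalgebra k K) (hB''O : B''.toSubring ≤ O.toSubring), A ≤ B'' ∧ B''.FG ∧
    IsRegularLocalRing (locAtCentre B''.toSubring O) ∧ ringKrullDim (locAtCentre B''.toSubring O) = 3 ∧
    locAtCentre B'.toSubring O ≤ locAtCentre B''.toSubring O ∧
    locAtCentre B''.toSubring O ≤ locAtCentre B'.toSubring O₁ ∧
    ∃ (h₁ : x / z ^ n ∈ locAtCentre B''.toSubring O) (h₂ : y / z ^ n ∈ locAtCentre B''.toSubring O) (h₃ : z ∈ locAtCentre B''.toSubring O),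
      (haveI := isLocalRing_locAtCentre hB''O; IsLocalRing.maximalIdeal (locAtCentre B''.toSubring O)) =
        Ideal.span {⟨_, h₁⟩, ⟨_, h₂⟩, ⟨_, h₃⟩} := by
  intro k _ K _ _ O A hAO hAfg hfrac hdimA hzd B' hB'O hAB' hB'fg hB'reg hB'dim O₁ hOO₁ x y z hx hy hz hmax hcen n
  classical
  haveI := hfrac
  haveI := isLocalRing_locAtCentre hB'O
  have hdimA3 : ringKrullDim A = 3 := by
    rw [← ringKrullDim_eq_of_fg_of_le hAfg hB'fg hAB', ← ringKrullDim_locAtCentre_eq_of_isMaximal B' hB'fg O hB'O (hzd _ hB'O fun w hw => hAB' hw)]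
    exact hB'dim
  have hd : (maximalIdeal ↥(locAtCentre B'.toSubring O)).spanFinrank = 3 := spanFinrank_eq_three_of_dim _ hB'dim
  have hzns : (⟨z, hz⟩ : ↥(locAtCentre B'.toSubring O)) ∉ Ideal.span ({⟨x, hx⟩, ⟨y, hy⟩} : Set _) :=
    not_mem_span_pair_of_rsp hd _ _ _ hmax
  have hvz : O₁.valuation z = 1 := by
    have h1 : ¬ O₁.valuation z < 1 := fun h => hzns ((hcen ⟨z, hz⟩).mp h)
    exact le_antisymm ((O₁.valuation_le_one_iff _).mpr (hOO₁ (locAtCentre_le hB'O hz))) (not_lt.mp h1)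
  have hvx : O₁.valuation x < 1 := (hcen ⟨x, hx⟩).mpr (Ideal.subset_span (by simp))
  have hvy : O₁.valuation y < 1 := (hcen ⟨y, hy⟩).mpr (Ideal.subset_span (by simp))
  have hdeep : ∀ w : K, O₁.valuation w < 1 → ∀ m : ℕ, O.valuation w < O.valuation (z ^ (m + 1)) := fun w hw m =>
    valuation_lt_of_lt_of_le hOO₁ (by rw [map_pow, hvz, one_pow]; exact hw)
  -- the ambient ring `R₁ = locAtCentre B' O₁`
  set R := locAtCentre B'.toSubring O₁ with hR
  have hRloc : locAtCentre R O ≤ R := locAtCentre_fine_le hOO₁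
  have hSR : locAtCentre B'.toSubring O ≤ R := le_locAtCentre_coarse hOO₁
  have hzinv : z⁻¹ ∈ R := inv_mem_locAtCentre (hSR hz) hvz
  -- first run: `(t, t₂, t₃) := (x, z, y)`
  have hmax₁ : maximalIdeal ↥(locAtCentre B'.toSubring O) = Ideal.span {⟨x, hx⟩, ⟨z, hz⟩, ⟨y, hy⟩} := by
    rw [hmax]; congr 1; ext v; simp only [Set.mem_insert_iff, Set.mem_singleton_iff]; tauto
  obtain ⟨A₂, hAA₂, hA₂fg, hA₂O, hreg₂, h12, hA₂R, h₁, h₂, h₃, hmax₂⟩ :=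
    exists_model_rsop_div_pow_le O A hAfg hzd hdimA3 R hRloc n B' hAB' hB'fg hB'O hB'reg x z y hx hz hy hmax₁ (hdeep x hvx) hSR hzinv
  -- second run: `(t, t₂, t₃) := (y, z, x / z ^ n)`
  haveI := isLocalRing_locAtCentre hA₂O
  have hmax₂' : maximalIdeal ↥(locAtCentre A₂.toSubring O) = Ideal.span {⟨y, h₃⟩, ⟨z, h₂⟩, ⟨x / z ^ n, h₁⟩} := by
    rw [hmax₂]; congr 1; ext v; simp only [Set.mem_insert_iff, Set.mem_singleton_iff]; tauto
  obtain ⟨A₃, hAA₃, hA₃fg, hA₃O, hreg₃, h23, hA₃R, g₁, g₂, g₃, hmax₃⟩ :=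
    exists_model_rsop_div_pow_le O A hAfg hzd hdimA3 R hRloc n A₂ hAA₂ hA₂fg hA₂O hreg₂ y z (x / z ^ n) h₃ h₂ h₁ hmax₂' (hdeep y hvy) hA₂R hzinv
  haveI := isLocalRing_locAtCentre hA₃O
  have hdim₃ : ringKrullDim ↥(locAtCentre A₃.toSubring O) = 3 := by
    rw [ringKrullDim_locAtCentre_eq_of_isMaximal A₃ hA₃fg O hA₃O (hzd _ hA₃O fun w hw => hAA₃ hw), ringKrullDim_eq_of_fg_of_le hAfg hA₃fg hAA₃, hdimA3]
  refine ⟨A₃, hA₃O, hAA₃, hA₃fg, hreg₃, hdim₃, h12.trans h23, hA₃R, g₃, g₁, g₂, ?_⟩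
  rw [hmax₃]; congr 1; ext v; simp only [Set.mem_insert_iff, Set.mem_singleton_iff]; tauto

end Summit.ResolutionOfSingularities.ResolutionOfSingularities.Theorems.RadicialJung.CleanModels.Ccurve

end
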